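import Summits.ABC.IUTFork.Joshi.ATS4GenuineResidualLambdaElevenFibres
import Summits.ABC.IUTFork.Joshi.ATS4DescentSpineGenuineResidualUnsatDegOne
import HarnessLib

/-!
# [J-IV] (arXiv:2403.10430v2) §6.10–§7.1, E5 descent spine at `d = 1`: the edge prime `ℓ = 7` — the GENUINE-COMPONENT residual is
# UNSATISFIABLE on the `ℚ`-family `μ_k = 1/2 + 2/11^k` (`p₀ = 11`) for EVERY prime `ℓ ≥ 7`, `ℓ ≠ 11` (R-J row Y-21 PARENT (r2)/(r4); E ROW R-27)

Proof-only companion (0 defs) of the abc-iut cell, sub-cell R-J «JOSHI Y-DISCHARGE CENSUS» (rung LADDER-ABC:A2.RESCUE.J; table of record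
`HOME/plan/E/R-J/Y-CENSUS.tsv`, row Y-21 PARENT), seat abc-iut-E-t35 (gen 12), E ROW R-27 (`HOME/plan/E/R-J/E-ROWS.md` §E) part (2), `d = 1`.
The census small print (r2) reads «`d = 1` covered in kernel on the `ℚ`-family `λ_k = 1/2 + 2/7^k` (`p₀ = 7`, every prime `ℓ ≥ 11`, `k ≥ 10⁷`)»
(this seat's gen-10 `LambdaSevenResidual.genuineResidualSupport_unsat`, p488306) — its EDGE: with `p₀ = 7` the excluded prime is `ℓ = 7` itself
(tameness of `K/F` above `p₀` needs `ℓ ≠ p₀`), although `ℓ = 7` IS admissible for the E5 binder (`ATS4.ITDConditions P ℓ := 7 ≤ ℓ ∧ …`).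
THIS FILE closes that edge with the SAME mechanism at the next prime `p₀ = 11 ∤ 2·46080`, on the `ℚ`-family `μ_k := 1/2 + 2/11^k` of the same
shape (a `K_V = CBData.std {2}` family: `|μ_k − 1/2| = 2/11^k ≤ 1/4`, `‖μ_k − 1/2‖₂ = ‖2‖₂` — `ratPoint_lamEleven_mem_std_two`), via the generic
degree-one lemmas `DegOne.*` of p487789:

* the point and its genuine `11`-components — companion `ATS4GenuineResidualLambdaElevenFibres` (`ord_11 j(μ_k) = −2k`, `log q^∀(μ_k) ≤ 6k·log 11
  + 12·log 2`, `q₁₁ = 2k·log 11` EXACTLY, `d₁₁ ≤ log 11` on the whole `ℓ`-division tower for `ℓ ≠ 11` since `11 ∤ 46080`, `11 ∈ V^dst_ℚ` forced);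
* §1 `localExcess_arith` at `p₀ = 11`, `d = 1` (`e*_mod ≤ 2¹²·3³·5`), every `ℓ ≥ 7`, `k ≥ 10⁷`: `q₁₁`-share `1/3`, failure ratio `ℓ(ℓ+1)/36`
  (`= 14/9 > 1` at `ℓ = 7`); core `396(k+1) < ℓ(ℓ+1)(11k − 11059233) − 264(ℓ+1)`, `k_fail(7) ≈ 2.82·10⁶`;
* §2 **`LambdaElevenResidual.genuineResidualSupport_unsat`** — the `∃`-body of p464392 §4 VERBATIM at `d := 1`, `P := ratPoint μ_k` (byte-identical,
  up to the point, to the body negated in p488306), FALSE for `k ≥ 10⁷` and EVERY prime `ℓ ≥ 7`, `ℓ ≠ 11`.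

With p488306 (`λ_k`, `p₀ = 7`, every prime `ℓ ≥ 11`) the `d = 1` small print now covers EVERY prime `ℓ ≥ 7` = every `ℓ` the E5 binder admits
(`ℓ = 7` and `ℓ ≥ 13` here, `ℓ = 11` there, `ℓ ≥ 13` on both families). NOT covered at `d = 1`, and why (located, on paper): `ℓ = 5` — binder-vacuous
(`not_itdConditions_five`, sequel `…UnsatEllFive`), and out of reach of the one-prime mechanism on ANY `K_V`-bounded `ℚ`-family: for `λ = u/v` near
`1/2` the pole classes `u`, `v − u`, `v` are pairwise coprime and of comparable size, so a single prime carries `≤ 1/3 + o(1)` of `log 𝔮_F`, below the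
share `12/ℓ(ℓ+1) = 2/5` the excess inequality needs at `ℓ = 5` (at `ℓ = 7` it needs `3/14 < 1/3`). SOURCE locators: [J-IV] Prop. 6.10.9 p.69
l.1–28, (6.11.1) p.69 l.73–p.70 l.3, p.70 l.4–29, p.71 l.107–110 (render `HOME/lit/renders/Joshi-arxiv-2403.10430/`); [IUTchIV] Thm. 1.10 Step (v)
p.27–28, Cor. 2.2 (ii) proof (P5) p.46 (kurims); [GenEll] Ex. 1.3 (i) p.5. FRAMING (binding): a located COUNTERMODEL to the E5 residual AS PRINTED
with (6.11.1)'s `Σ|·|` convention, at OUR typed carriers, `d = 1` — not to any author's theorem; NO side taken on [IUTchIII] Cor. 3.12 / [IUTchIV]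
Thm. 1.10, on Joshi's claims or on Mochizuki's report on them; NOT an abc claim (nothing here proves or refutes abc); typed ≠ proved ≠ endorsed.
Theorems only; standard axioms; FACT rows none. [claim: Joshi2024ATS4, status: disputed].
-/

noncomputable section

namespace Summit.ABC.IUTFork.Joshi.ATS4

open NumberField IsDedekindDomain Finset Metric
open Literature.IUT.LogVolume Literature.IUT.LogVolume.Cor22
open Literature.NumberTheory.DiophantineGeometry Literature.NumberTheory.DiophantineGeometry.GenEll
open Literature.NumberTheory.EllipticCurves
open scoped Classical

namespace LambdaElevenResidual

/-! ## 1. The real arithmetic of the local excess at `p₀ = 11`, `d = 1` -/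

/-- **The local excess at `11` beats the global cap, for every `ℓ ≥ 7`** (pure real arithmetic): with `Q ≤ 6k·log 11 + 12·log 2` (total `log 𝔮_F ≤
log q^∀(μ_k)`), `q ≥ 2k·log 11` (the `11`-component of `log q`), `d ≤ log 11` (the `11`-component of `log 𝔡_K`), `E ≤ 552960 = 2¹²3³5` (`e*_mod` at
`e_mod ≤ d_mod ≤ 1`) and `0 ≤ ι ≤ (log 11)/11` (the Mertens weight), and `k ≥ 10⁷`:
`(1/2ℓ)·Q < ((ℓ+1)/4)·(q/6 − (1+4/ℓ)·d − (4/ℓ)·log 11 − (20/3)·E·ι)` — with `12·log 2 ≤ 6·log 11` and after dividing by `log 11 > 0` this follows from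
`396(k+1) < ℓ(ℓ+1)(11k − 11059233) − 264(ℓ+1)`, increasing in `ℓ`, true at `ℓ = 7` once `k > 2 815 088`. (Failure ratio `ℓ(ℓ+1)/36` of the `q₁₁`-share
`1/3`; `= 14/9` at `ℓ = 7`, `< 1` at `ℓ = 5`.) [folklore] -/
theorem localExcess_arith {ℓ k Q q d E ι : ℝ} (hℓ : 7 ≤ ℓ) (hk : 10 ^ 7 ≤ k) (hQ : Q ≤ 6 * k * Real.log 11 + 12 * Real.log 2)
    (hq : 2 * k * Real.log 11 ≤ q) (hd : d ≤ Real.log 11) (hE : E ≤ 552960) (hι0 : 0 ≤ ι) (hι : ι ≤ Real.log 11 / 11) :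
    1 / (2 * ℓ) * Q < (ℓ + 1) / 4 * (1 / 6 * q - (1 + 4 / ℓ) * d - 4 / ℓ * Real.log 11 - 20 / 3 * E * ι) := by
  have hL : 0 < Real.log 11 := Real.log_pos (by norm_num)
  have hℓ0 : 0 < ℓ := by linarith
  -- `12·log 2 ≤ 6·log 11`
  have hlog2 : 2 * Real.log 2 ≤ Real.log 11 := by
    have h := Real.log_le_log (by norm_num : (0 : ℝ) < 2 ^ 2) (by norm_num : (2 : ℝ) ^ 2 ≤ 11)
    rw [Real.log_pow] at h
    push_cast at h
    linarith
  have hQ' : Q ≤ (6 * k + 6) * Real.log 11 := by nlinarith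
  -- the polynomial core: `396(k+1) < ℓ(ℓ+1)(11k − 11059233) − 264(ℓ+1)`
  have hA : 0 ≤ 11 * k - 11059233 := by linarith
  have h1 : 7 * (11 * k - 11059233) - 264 ≤ ℓ * (11 * k - 11059233) - 264 := by nlinarith
  have h1' : 0 ≤ 7 * (11 * k - 11059233) - 264 := by linarith
  have h2 : 8 * (7 * (11 * k - 11059233) - 264) ≤ (ℓ + 1) * (ℓ * (11 * k - 11059233) - 264) := by nlinarith
  have key : 396 * (k + 1) < ℓ * (ℓ + 1) * (11 * k - 11059233) - 264 * (ℓ + 1) := by nlinarith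
  -- divide by `132ℓ`
  have hred : 3 * (k + 1) / ℓ < (ℓ + 1) / 4 * (k / 3 - 1 - 8 / ℓ - 3686400 / 11) := by
    have e1 : 3 * (k + 1) / ℓ = 396 * (k + 1) / (132 * ℓ) := by field_simp; ring
    have e2 : (ℓ + 1) / 4 * (k / 3 - 1 - 8 / ℓ - 3686400 / 11) = (ℓ * (ℓ + 1) * (11 * k - 11059233) - 264 * (ℓ + 1)) / (132 * ℓ) := by
      field_simp; ring
    rw [e1, e2]
    exact div_lt_div_of_pos_right key (by positivity)
  -- multiply by `log 11` and compare with the two sides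
  have hlhs : 1 / (2 * ℓ) * Q ≤ Real.log 11 * (3 * (k + 1) / ℓ) := by
    have : 1 / (2 * ℓ) * Q ≤ 1 / (2 * ℓ) * ((6 * k + 6) * Real.log 11) := mul_le_mul_of_nonneg_left hQ' (by positivity)
    calc 1 / (2 * ℓ) * Q ≤ 1 / (2 * ℓ) * ((6 * k + 6) * Real.log 11) := this
      _ = Real.log 11 * (3 * (k + 1) / ℓ) := by field_simp; ring
  have hEι : E * ι ≤ 552960 * (Real.log 11 / 11) := mul_le_mul hE hι hι0 (by norm_num)
  have hcoef : 0 ≤ 1 + 4 / ℓ := by positivity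
  have hdd : (1 + 4 / ℓ) * d ≤ (1 + 4 / ℓ) * Real.log 11 := mul_le_mul_of_nonneg_left hd hcoef
  have hrhs : Real.log 11 * ((ℓ + 1) / 4 * (k / 3 - 1 - 8 / ℓ - 3686400 / 11)) ≤
      (ℓ + 1) / 4 * (1 / 6 * q - (1 + 4 / ℓ) * d - 4 / ℓ * Real.log 11 - 20 / 3 * E * ι) := by
    have hin : Real.log 11 * (k / 3 - 1 - 8 / ℓ - 3686400 / 11) ≤
        1 / 6 * q - (1 + 4 / ℓ) * d - 4 / ℓ * Real.log 11 - 20 / 3 * E * ι := by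
      have e3 : Real.log 11 * (k / 3 - 1 - 8 / ℓ - 3686400 / 11) =
          1 / 6 * (2 * k * Real.log 11) - (1 + 4 / ℓ) * Real.log 11 - 4 / ℓ * Real.log 11
            - 20 / 3 * (552960 * (Real.log 11 / 11)) := by
        field_simp; ring
      rw [e3]; linarith
    have hc4 : 0 ≤ (ℓ + 1) / 4 := by positivity
    calc Real.log 11 * ((ℓ + 1) / 4 * (k / 3 - 1 - 8 / ℓ - 3686400 / 11))
        = (ℓ + 1) / 4 * (Real.log 11 * (k / 3 - 1 - 8 / ℓ - 3686400 / 11)) := by ring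
      _ ≤ (ℓ + 1) / 4 * (1 / 6 * q - (1 + 4 / ℓ) * d - 4 / ℓ * Real.log 11 - 20 / 3 * E * ι) :=
          mul_le_mul_of_nonneg_left hin hc4
  exact lt_of_le_of_lt hlhs (lt_of_lt_of_le (mul_lt_mul_of_pos_left hred hL) hrhs)

/-! ## 2. THE COUNTERMODEL AT `d = 1`, `p₀ = 11`: the genuine-component residual is unsatisfiable at `μ_k`, every prime `ℓ ≥ 7`, `ℓ ≠ 11` -/

/-- **The GENUINE-COMPONENT residual (R4′) ∧ (R5) of `abc_of_genuineResidualSupport` (p464392 §4) is UNSATISFIABLE at the `ℚ`-point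
`μ_k = 1/2 + 2/11^k` (`k ≥ 10⁷`), `d = 1`, for EVERY prime `ℓ ≥ 7`, `ℓ ≠ 11` (window-free) — in particular at the binder's edge prime `ℓ = 7`.** The body
below is that theorem's `∃`-body VERBATIM at `d := 1`, `P := ratPoint μ_k`. Whatever theta field `F`, division tower `K ⊆ F(E_F[ℓ])`, `L_mod` (`e_mod ≤
d_mod ≤ 1`), `V^dst_ℚ` (forced to contain `11`: `exists_mem_V_residueChar_eq_eleven`), bookkeeping `D_K`, and local hull log-volumes the supplier returns:
at `p₀ = 11` the genuine components are `q₁₁ = 2k·log 11` (`qEleven_eq`) and `d₁₁ ≤ log 11` (`dEleven_le`), `log 𝔮_F = log q^{∤{2,ℓ}}(μ_k) ≤ log q^∀(μ_k)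
≤ 6k·log 11 + 12·log 2` (Prop. 4.4.4 `logq_ofNFPointOver_eq_logQAvoid`, `Cor22.logQAvoid_anti`, `logQForall_ratPoint_lamEleven_le`), so the local excess
beats the global cap (`localExcess_arith`) and E-t50's `not_exists_volumes_of_localExcess` (p470440: (6.11.1) sums `|vol_p|`, no other prime absorbs it)
leaves NO `(vol, vol_∞)`. A located COUNTERMODEL to the E5 residual AS PRINTED with (6.11.1)'s `Σ|·|` convention, at `d = 1` — not to any author's
theorem; NO side taken on [IUTchIII] Cor. 3.12 / [IUTchIV] Thm. 1.10; NOT an abc claim. [claim: Joshi2024ATS4, status: disputed] -/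
theorem genuineResidualSupport_unsat {k : ℕ} (hk : 10 ^ 7 ≤ k) {ℓ : ℕ} (hℓ : ℓ.Prime) (h7 : 7 ≤ ℓ) (hℓ11 : ℓ ≠ 11) :
    ¬ ∃ (F : Type) (_ : Field F) (_ : NumberField F) (_ : Algebra (ratPoint ((2 : ℚ)⁻¹ + 2 / 11 ^ k)).F F)
          (K : Type) (_ : Field K) (_ : NumberField K) (_ : Algebra F K) (_ : Algebra (ratPoint ((2 : ℚ)⁻¹ + 2 / 11 ^ k)).F K)
          (_ : IsScalarTower (ratPoint ((2 : ℚ)⁻¹ + 2 / 11 ^ k)).F F K)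
          (_ : IsGalois F K) (ψ : K →ₐ[F] AlgebraicClosure F) (hU : (ratPoint ((2 : ℚ)⁻¹ + 2 / 11 ^ k)).InU)
          (_ : IsThetaField (ratPoint ((2 : ℚ)⁻¹ + 2 / 11 ^ k)) F)
          (_ : letI := thetaCurve_isElliptic hU F
            ((thetaCurve (ratPoint ((2 : ℚ)⁻¹ + 2 / 11 ^ k)) F).galoisRepTorsion (ℓ : ℤ)).ker ≤ ψ.fieldRange.fixingSubgroup)
          (_ : 0 < (TateDivisorDatum.ofNFPointOver (ratPoint ((2 : ℚ)⁻¹ + 2 / 11 ^ k)) {2, ℓ} F).logq)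
          (Lmod : Type) (_ : Field Lmod) (_ : NumberField Lmod) (_ : Cor22.dmod (ratPoint ((2 : ℚ)⁻¹ + 2 / 11 ^ k)) ≤ dMod Lmod)
          (_ : dMod Lmod ≤ 1)
          (V : Finset ℕ)
          (_ : ∀ q ∈ V, q.Prime ∧ (q ∣ 2 * 3 * 5 * ℓ ∨
            (∃ v ∈ badPlacesAvoid (ratPoint ((2 : ℚ)⁻¹ + 2 / 11 ^ k)) {2, ℓ}, residueChar (ratPoint ((2 : ℚ)⁻¹ + 2 / 11 ^ k)).F v = q) ∨
            ∃ u : HeightOneSpectrum (𝓞 K), residueChar K u = q ∧ 2 ≤ u.asIdeal.ramificationIdx ℤ))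
          (_ : ∀ u : HeightOneSpectrum (𝓞 K), 2 ≤ u.asIdeal.ramificationIdx ℤ → residueChar K u ∈ V)
          (_ : ∀ w ∈ (TateDivisorDatum.ofNFPointOver (ratPoint ((2 : ℚ)⁻¹ + 2 / 11 ^ k)) {2, ℓ} F).V, residueChar F w ∈ V)
          (DK : Finset (HeightOneSpectrum (𝓞 K))) (_ : ∀ u, differentDivisor K (Sum.inr u) ≠ 0 → u ∈ DK)
          (vol : ℕ → ℝ) (volArch : ℝ),
          (∀ p ∈ V, -(1 / (((ℓ : ℝ) - 1) / 2)) * |vol p| ≤ ((ℓ : ℝ) + 1) / 4 *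
            ((1 + 4 / (ℓ : ℝ)) *
                ((Module.finrank ℚ K : ℝ)⁻¹ *
                  ∑ u ∈ DK with residueChar K u = p, differentDivisor K (Sum.inr u) * logNorm K u)
              - 1 / 6 *
                ((Module.finrank ℚ F : ℝ)⁻¹ *
                  ∑ w ∈ (TateDivisorDatum.ofNFPointOver (ratPoint ((2 : ℚ)⁻¹ + 2 / 11 ^ k)) {2, ℓ} F).V with residueChar F w = p,
                    (TateDivisorDatum.ofNFPointOver (ratPoint ((2 : ℚ)⁻¹ + 2 / 11 ^ k)) {2, ℓ} F).tateDivisor (Sum.inr w) * logNorm F w)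
              + 4 / (ℓ : ℝ) * Real.log p
              + 20 / 3 * ((2 ^ 12 * 3 ^ 3 * 5 * eMod Lmod : ℕ) : ℝ) *
                (if p ≤ 2 ^ 12 * 3 ^ 3 * 5 * eMod Lmod * ℓ then Real.log p / p else 0))) ∧
          -(1 / (2 * (ℓ : ℝ)) * (TateDivisorDatum.ofNFPointOver (ratPoint ((2 : ℚ)⁻¹ + 2 / 11 ^ k)) {2, ℓ} F).logq) ≤
            -(1 / (((ℓ : ℝ) - 1) / 2)) * (∑ p ∈ V, |vol p| + |volArch|) := by
  rintro ⟨F, _, _, _, K, _, _, _, _, _, _, ψ, hU, hF, hK, -, Lmod, _, _, -, hdmod, V, -, -, hbad, DK, -, vol, volArch,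
    hStepV, hLower⟩
  have hk1 : 1 ≤ k := le_trans (by norm_num) hk
  -- `11 ∈ V^dst_ℚ`
  obtain ⟨w₁₁, hw₁₁, hres₁₁⟩ := exists_mem_V_residueChar_eq_eleven hk1 hℓ hℓ11 F
  have h11V : 11 ∈ V := hres₁₁ ▸ hbad w₁₁ hw₁₁
  -- the three genuine numbers at `p₀ = 11`
  have hq11 := qEleven_eq hk1 hℓ hℓ11 F
  have hd11 := dEleven_le ψ hU hF hℓ hℓ11 hK DK
  have hQ : (TateDivisorDatum.ofNFPointOver (ratPoint ((2 : ℚ)⁻¹ + 2 / 11 ^ k)) {2, ℓ} F).logq ≤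
      6 * k * Real.log 11 + 12 * Real.log 2 := by
    rw [TateDivisorDatum.logq_ofNFPointOver_eq_logQAvoid]
    exact (logQAvoid_anti _ (Finset.empty_subset _)).trans (logQForall_ratPoint_lamEleven_le hk1)
  -- the Mertens coefficient `e*_mod ≤ 2¹²3³5` and weight `ι₁₁ ≤ (log 11)/11`
  have hE : (((2 ^ 12 * 3 ^ 3 * 5 * eMod Lmod : ℕ) : ℝ)) ≤ 552960 := by
    have h := (eMod_le_dMod (Lmod := Lmod)).trans hdmod
    have : ((eMod Lmod : ℕ) : ℝ) ≤ 1 := by exact_mod_cast h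
    push_cast; nlinarith
  have hι : ∀ N : ℕ, (0 : ℝ) ≤ (if 11 ≤ N then Real.log 11 / 11 else 0) ∧
      (if 11 ≤ N then Real.log 11 / 11 else 0) ≤ Real.log 11 / 11 := by
    intro N
    have : 0 ≤ Real.log 11 / 11 := div_nonneg (Real.log_nonneg (by norm_num)) (by norm_num)
    split_ifs <;> exact ⟨by positivity, by linarith⟩
  refine not_exists_volumes_of_localExcess ℓ (by omega) V
    (fun p => (Module.finrank ℚ K : ℝ)⁻¹ * ∑ u ∈ DK with residueChar K u = p, differentDivisor K (Sum.inr u) * logNorm K u)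
    (fun p => (Module.finrank ℚ F : ℝ)⁻¹ *
      ∑ w ∈ (TateDivisorDatum.ofNFPointOver (ratPoint ((2 : ℚ)⁻¹ + 2 / 11 ^ k)) {2, ℓ} F).V with residueChar F w = p,
        (TateDivisorDatum.ofNFPointOver (ratPoint ((2 : ℚ)⁻¹ + 2 / 11 ^ k)) {2, ℓ} F).tateDivisor (Sum.inr w) * logNorm F w)
    ((2 ^ 12 * 3 ^ 3 * 5 * eMod Lmod : ℕ) : ℝ) _ (2 ^ 12 * 3 ^ 3 * 5 * eMod Lmod * ℓ) h11V ?_ ⟨vol, volArch, hStepV, hLower⟩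
  have h11 : ((11 : ℕ) : ℝ) = 11 := by norm_num
  simp only [h11]
  exact localExcess_arith (by exact_mod_cast h7) (by exact_mod_cast hk) hQ hq11.ge hd11 hE (hι _).1 (hι _).2

end LambdaElevenResidual

end Summit.ABC.IUTFork.Joshi.ATS4

end
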